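import Mathlib
import Summits.Ventures.Crystal3D.Theorems.StickyWulffConstantTextureLiminfTentFrame
import Summits.Ventures.Crystal3D.Theorems.StickyWulffConstantTextureLiminfTentCellKinds
import Summits.Ventures.Crystal3D.Theorems.StickyWulffConstantTextureLiminfTexShadowVocabulary
import Literature.MathematicalPhysics.StatisticalMechanics.FccWulffBodyHull
import Literature.Analysis.Convexity.SupportFunction
import Literature.Barriers.AtomisticToContinuum.ShortRangeStackingBlindnessProofs
import HarnessLib

/-!
# The tent certificate — the Barlow-frame surface tension `phiB` IS `phiFcc` through `toRef` (eng g9)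

Route `StickyWulffConstant` (`Summits/Ventures/Crystal3D`, cell `crystal3d-full`), support toward the crux
`TextureLiminf` (stmt-Ventures-19483), line TexShadow v6.2, stub `stub_barlowFreeCertificate`, step (2′):
* `fccRef` (`= fccStacking 1 √(2/3)`) is a lattice (`sub_mem_fccRef`), and its twelve unit vectors are the
  `toRef`-images of the cubic bond vectors `site δ`, `δ ∈ fccOffsets` (`unitVec_eq_image`);
* hence the line's bond-counting surface tension `phiB` is the cubic `phiFcc` read through the frame:
  `phiB ν = phiFcc (toRef.symm ν)` (`phiB_eq_phiFcc`), and the Wulff body of a grain with frame `A` is the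
  moved cubic Wulff body: `wulffOf A = (toRef.trans A) '' fccWulffBody` (`wulffOf_eq_image`);
* FRAME UNIQUENESS (the «one lemma» of HOME/eng/MEMO-9 §F): two fcc frames carrying one close-packed
  bilayer have the same Wulff body — if `(A' · + u') '' B ⊆ (A · + u) '' fccRef` for a set `B ⊆ ℝ³` whose
  differences contain the twelve unit vectors of `fccRef` (every bilayer does), then `A⁻¹ ∘ A'` permutes
  those twelve vectors, `phiB` is invariant, and `wulffOf A' = wulffOf A` (`wulffOf_eq_of_subset`).
WHAT THIS IS NOT: the certificate; F-C1 not moved.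
-/

noncomputable section

namespace Summit.Ventures.Crystal3D.TentCertificate

open Finset Summit.Ventures.Crystal3D MeasureTheory
open Literature.Geometry.DiscreteGeometry (intVec intVec_apply fccInt fccKissingPattern scaledPattern sqNormInt)
open Literature.MathematicalPhysics.StatisticalMechanics (fccStacking barlowStacking barlowPos barlowLayer
  constHagg phiFcc fccWulffBody phiFcc_eq_bondSum fccWulffBody_eq_setOf_forall_inner)
open Summit.Ventures.Crystal3D.Cruxes.TextureLiminf.TexShadow (fccRef phiB wulffOf)
open scoped RealInnerProductSpace

/-! ## `fccRef` is the image of the site lattice; it is a lattice -/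

/-- The line's reference lattice is the reference stacking of the frame file. -/
theorem fccRef_eq : fccRef = fccStacking 1 hB := rfl

/-- `site` is subtractive. -/
theorem site_sub (a b : Site) : site (a - b) = site a - site b := by
  have h := site_add (a - b) b
  rw [sub_add_cancel] at h
  rw [h, add_sub_cancel_right]

/-- `site 0 = 0`. -/
theorem site_zero : site (0 : Site) = 0 := by
  have h := site_sub 0 0
  rwa [sub_self, sub_self] at h

/-- Every point of `fccRef` is the `toRef`-image of a site. -/
theorem exists_site_of_mem_fccRef {r : E3} (hr : r ∈ fccRef) : ∃ n : Site, toRef (site n) = r :=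
  exists_site_of_mem_fccStacking hr

/-- `toRef (site n) ∈ fccRef`. -/
theorem toRef_site_mem_fccRef (n : Site) : toRef (site n) ∈ fccRef := toRef_site_mem_fccStacking n

/-- `0 ∈ fccRef`. -/
theorem zero_mem_fccRef : (0 : E3) ∈ fccRef := by
  have h := toRef_site_mem_fccRef 0
  rwa [site_zero, map_zero] at h

/-- **`fccRef` is closed under subtraction.** -/
theorem sub_mem_fccRef {x y : E3} (hx : x ∈ fccRef) (hy : y ∈ fccRef) : x - y ∈ fccRef := by
  obtain ⟨n, rfl⟩ := exists_site_of_mem_fccRef hx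
  obtain ⟨m, rfl⟩ := exists_site_of_mem_fccRef hy
  rw [← map_sub, ← site_sub]
  exact toRef_site_mem_fccRef _

/-- `fccRef` is closed under negation. -/
theorem neg_mem_fccRef {x : E3} (hx : x ∈ fccRef) : -x ∈ fccRef := by
  simpa using sub_mem_fccRef zero_mem_fccRef hx

/-! ## The twelve unit vectors -/

/-- The cubic bond vectors have norm `1`. -/
theorem norm_site_of_mem_fccOffsets {δ : Site} (hδ : δ ∈ fccOffsets) : ‖site δ‖ = 1 := by
  have h2 := sqNormInt_fccOffsets δ hδ
  have hs : (0 : ℝ) < Real.sqrt 2 := by positivity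
  rw [site_eq]
  rw [norm_smul, norm_inv, Real.norm_of_nonneg hs.le, Literature.Geometry.DiscreteGeometry.norm_intVec, h2]
  push_cast
  exact inv_mul_cancel₀ hs.ne'

/-- The twelve unit vectors of `fccRef`. -/
def unitVec : Set E3 := {w | w ∈ fccRef ∧ ‖w‖ = 1}

/-- `unitVec` is the intersection of `fccRef` with the unit sphere. -/
theorem unitVec_eq_inter_sphere : unitVec = fccStacking 1 hB ∩ Metric.sphere (0 : E3) 1 := by
  ext w; simp [unitVec, fccRef_eq]

/-- There are twelve unit vectors. -/
theorem ncard_unitVec : unitVec.ncard = 12 := by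
  rw [unitVec_eq_inter_sphere]
  have h0 : (0 : E3) ∈ fccStacking 1 hB := by rw [← fccRef_eq]; exact zero_mem_fccRef
  exact (Literature.Barriers.AtomisticToContinuum.ConwaySloane1999_fccShells_holds 0 h0).1

/-- `unitVec` is finite. -/
theorem unitVec_finite : unitVec.Finite := Set.finite_of_ncard_ne_zero (by rw [ncard_unitVec]; norm_num)

/-- The images of the cubic bond vectors are unit vectors of `fccRef`. -/
theorem toRef_site_mem_unitVec {δ : Site} (hδ : δ ∈ fccOffsets) : toRef (site δ) ∈ unitVec :=
  ⟨toRef_site_mem_fccRef δ, by rw [LinearIsometryEquiv.norm_map]; exact norm_site_of_mem_fccOffsets hδ⟩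

/-- `site` is injective. -/
theorem site_injective : Function.Injective site := by
  intro a b h
  have h' : site (a - b) = 0 := by rw [site_sub, h, sub_self]
  rw [site_eq, smul_eq_zero] at h'
  rcases h' with h' | h'
  · exact absurd h' (inv_ne_zero (by positivity))
  · have h'' : intVec (fccPoint (a - b)) = intVec 0 := by rw [h']; ext i; simp [intVec_apply]
    exact sub_eq_zero.1 (fccPoint_eq_zero (Literature.Geometry.DiscreteGeometry.intVec_injective h''))

/-- **The twelve unit vectors of `fccRef` are exactly the images of the twelve cubic bond vectors.** -/
theorem unitVec_eq_image : unitVec = (fun δ => toRef (site δ)) '' (fccOffsets : Set Site) := by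
  symm
  have hinj : Function.Injective (fun δ : Site => toRef (site δ)) := fun a b h => site_injective (toRef.injective h)
  refine Set.eq_of_subset_of_ncard_le (fun w ⟨δ, hδ, hw⟩ => hw ▸ toRef_site_mem_unitVec hδ) ?_ unitVec_finite
  rw [ncard_unitVec, Set.ncard_image_of_injective _ hinj, Set.ncard_coe_finset, card_fccOffsets]

/-! ## `phiB` is `phiFcc` through the frame -/

/-- The integer bond vectors of the two files agree: `fccInt = fccPoint '' fccOffsets`. -/
theorem fccInt_eq_image : fccInt = fccOffsets.image fccPoint := by decide

/-- The cubic kissing pattern is `site '' fccOffsets`. -/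
theorem fccKissingPattern_eq_image : fccKissingPattern = fccOffsets.image site := by
  rw [fccKissingPattern, scaledPattern, fccInt_eq_image, Finset.image_image]
  refine Finset.image_congr fun δ _ => ?_
  simp only [Function.comp_apply, Nat.cast_ofNat]
  rfl

/-- **`phiB = phiFcc ∘ toRef⁻¹`.** -/
theorem phiB_eq_phiFcc (ν : E3) : phiB ν = phiFcc (toRef.symm ν) := by
  rw [phiB, phiFcc_eq_bondSum, fccKissingPattern_eq_image, Finset.sum_image site_injective.injOn]
  congr 1
  have hinj : Function.Injective (fun δ : Site => toRef (site δ)) := fun a b h => site_injective (toRef.injective h)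
  rw [show {w | w ∈ fccRef ∧ ‖w‖ = 1} = unitVec from rfl, unitVec_eq_image,
    finsum_mem_image hinj.injOn, finsum_mem_coe_finset]
  refine Finset.sum_congr rfl fun δ _ => ?_
  rw [← toRef.inner_map_map (site δ) (toRef.symm ν), toRef.apply_symm_apply]

/-- **The Wulff body of a grain with frame `A` is the moved cubic Wulff body.** -/
theorem wulffOf_eq_image (A : E3 ≃ₗᵢ[ℝ] E3) : wulffOf A = (toRef.trans A) '' fccWulffBody := by
  rw [fccWulffBody_eq_setOf_forall_inner,
    Literature.Analysis.Convexity.image_linearIsometryEquiv_setOf_forall_inner_le]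
  ext y
  simp only [wulffOf, Set.mem_setOf_eq, phiB_eq_phiFcc, LinearIsometryEquiv.symm_trans,
    LinearIsometryEquiv.trans_apply]

/-! ## Frame uniqueness -/

/-- Every unit vector of `fccRef` is a difference of two points of the reference bilayer `B₀`
(layers `0` and `1` of `fccRef`, i.e. the images of the sites of layers `0, 1`). -/
theorem unitVec_subset_sub :
    unitVec ⊆ {w | ∃ b ∈ toRef '' (site '' {n | layer n = 0 ∨ layer n = 1}),
      ∃ b' ∈ toRef '' (site '' {n | layer n = 0 ∨ layer n = 1}), w = b - b'} := by
  rw [unitVec_eq_image]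
  rintro _ ⟨δ, hδ, rfl⟩
  have hlay : ∀ d ∈ fccOffsets, layer d = 1 ∨ layer d = 0 ∨ layer d = -1 := by decide
  have h0 : (0 : E3) ∈ toRef '' (site '' {n | layer n = 0 ∨ layer n = 1}) :=
    ⟨site 0, ⟨0, Or.inl rfl, rfl⟩, by rw [site_zero, map_zero]⟩
  rcases hlay δ hδ with h | h | h
  · exact ⟨_, ⟨_, ⟨δ, Or.inr h, rfl⟩, rfl⟩, 0, h0, (sub_zero _).symm⟩
  · exact ⟨_, ⟨_, ⟨δ, Or.inl h, rfl⟩, rfl⟩, 0, h0, (sub_zero _).symm⟩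
  · refine ⟨0, h0, toRef (site (-δ)), ⟨_, ⟨-δ, Or.inr ?_, rfl⟩, rfl⟩, ?_⟩
    · simp only [layer, Pi.neg_apply] at h ⊢; omega
    · rw [show -δ = 0 - δ from (zero_sub δ).symm, site_sub, site_zero, map_sub, map_zero]; abel

/-- **Frame uniqueness, permutation form**: if the motion `A' · + u'` maps a set `B` into the moved lattice
`(A · + u) '' fccRef` and the differences of `B` contain every unit vector of `fccRef`, then
`g = A⁻¹ ∘ A'` maps the twelve unit vectors of `fccRef` onto themselves. -/
theorem mapsTo_unitVec_of_subset {A A' : E3 ≃ₗᵢ[ℝ] E3} {u u' : E3} {B : Set E3}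
    (hB : (fun r => A' r + u') '' B ⊆ (fun r => A r + u) '' fccRef)
    (hsub : unitVec ⊆ {w | ∃ b ∈ B, ∃ b' ∈ B, w = b - b'}) :
    Set.BijOn (fun w => A.symm (A' w)) unitVec unitVec := by
  have hmaps : Set.MapsTo (fun w => A.symm (A' w)) unitVec unitVec := by
    intro w hw
    obtain ⟨b, hb, b', hb', rfl⟩ := hsub hw
    obtain ⟨f, hf, hfe⟩ := hB ⟨b, hb, rfl⟩
    obtain ⟨f', hf', hfe'⟩ := hB ⟨b', hb', rfl⟩
    simp only at hfe hfe'
    refine ⟨?_, ?_⟩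
    · have : A.symm (A' (b - b')) = f - f' := by
        apply A.injective
        rw [A.apply_symm_apply, map_sub, map_sub]
        have e1 : A' b = A f + u - u' := by rw [hfe, add_sub_cancel_right]
        have e2 : A' b' = A f' + u - u' := by rw [hfe', add_sub_cancel_right]
        rw [e1, e2]; abel
      show A.symm (A' (b - b')) ∈ fccRef
      rw [this]; exact sub_mem_fccRef hf hf'
    · rw [LinearIsometryEquiv.norm_map, LinearIsometryEquiv.norm_map]; exact hw.2
  have hinj : Set.InjOn (fun w => A.symm (A' w)) unitVec :=
    fun x _ y _ h => A'.injective (A.symm.injective h)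
  exact unitVec_finite.injOn_iff_bijOn_of_mapsTo hmaps |>.1 hinj

/-- `phiB` is invariant under a linear isometry permuting the twelve unit vectors. -/
theorem phiB_symm_of_bijOn {g : E3 ≃ₗᵢ[ℝ] E3} (hg : Set.BijOn g unitVec unitVec) (ν : E3) :
    phiB (g.symm ν) = phiB ν := by
  unfold phiB
  congr 1
  rw [show {w | w ∈ fccRef ∧ ‖w‖ = 1} = unitVec from rfl]
  refine finsum_mem_eq_of_bijOn g hg fun w _ => ?_
  rw [← g.inner_map_map w (g.symm ν), g.apply_symm_apply]

/-- **Frame uniqueness**: two fcc frames carrying one close-packed bilayer (more generally: a set `B`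
whose differences contain the twelve unit vectors of `fccRef`) have the same Wulff body. -/
theorem wulffOf_eq_of_subset {A A' : E3 ≃ₗᵢ[ℝ] E3} {u u' : E3} {B : Set E3}
    (hB : (fun r => A' r + u') '' B ⊆ (fun r => A r + u) '' fccRef)
    (hsub : unitVec ⊆ {w | ∃ b ∈ B, ∃ b' ∈ B, w = b - b'}) : wulffOf A' = wulffOf A := by
  have hbij := mapsTo_unitVec_of_subset hB hsub
  -- `g = A⁻¹ A'` as a linear isometry
  have hg : Set.BijOn (A'.trans A.symm) unitVec unitVec := hbij
  ext y
  simp only [wulffOf, Set.mem_setOf_eq]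
  have key : ∀ ν, phiB (A'.symm ν) = phiB (A.symm ν) := by
    intro ν
    have h := phiB_symm_of_bijOn hg (A.symm ν)
    rw [LinearIsometryEquiv.symm_trans, LinearIsometryEquiv.trans_apply, LinearIsometryEquiv.symm_symm,
      A.apply_symm_apply] at h
    exact h
  simp only [key]

end Summit.Ventures.Crystal3D.TentCertificate

end
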